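import Summits.Ventures.LatticeQCDFlow.Scaling.CollectorFloor
import Literature.Probability.MarkovChains.ExpanderMixingTime
import Literature.Probability.MarkovChains.ContinuousTimeMixing

/-!
HONEST FRAMING: exact (Metropolis-corrected) sampling algorithms for lattice gauge theory; figures
of merit are autocorrelation/cost numbers at stated couplings and volumes; no continuum-physics
claim.

# LazyCollectorFloor — LAZINESS IS AN IDLE MOVE: THE LAZY VERSION `(I + P)/2` OF A MIXTURE OF LOCAL MOVES IS AGAIN ONE
# (THE IDENTITY KERNEL WITH WEIGHT `1/2`, TOUCHING NOTHING), ITS TOUCH RATES ARE HALVED, SO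
# `t_mix^{lazy}(ε) ≥ (2/θ − 1)·log(|T|·η)`; AND THE AVERAGE FORM OF THE COLLECTOR BOUND:
# `Σ_{k∈T} θ_k ≤ Θ < |T|`, `n ≤ (|T|/Θ − 1)·log(|T|η) ⇒ s_n ≥ 1/η` (lean-2 GEN-24, ours)

Venture-side (OURS).  Cell `lqcd-flow` (pub-lqcd), unit `pub-lqcd-lean-2-g24`, 2026-08-27.  Chapter L (the coupon-collector
law from a cold start), file 6.  The mixing-time ceilings of chapter K (`Scaling/HubListCurrencies`) are stated for the
LAZY chain `lazyVersion P = (I + P)/2` (Levin–Peres–Wilmer §12.2 needs laziness); to set the coupon-collector floor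
against them the floor must be available for the lazy chain too.  In the hypothesis-equation format of
`Scaling/UntouchedReplicas` this is immediate: index the moves by `Option ι`, `none` = the identity kernel with weight
`1/2` and touched set `∅`, `some a` = the move `a` with weight `c_a/2`.  Also proved here: the AVERAGE form of
`Scaling/CollectorFloor`'s `touchSum_ge_of_le_log` (Jensen), needed whenever the touch rates are not uniform on `T`
(every proposal law over the hub edges, `Scaling/HubCollectorLaw`).

## What is proved

* §1 `lazy_weights_nonneg`, `lazy_weights_sum`, `lazy_kernels_isRowStochastic`, `lazy_kernels_local`,
  **`lazyVersion_eq_mixture`** (`(I+P)/2 = Σ_{o : Option ι} c'_o·Pm'_o`), **`lazy_touchRate`** (`θ'_k = θ_k/2`),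
  `lazy_independent`.
* §2 **`touchSum_ge_of_sum_le_log` (AVERAGE FORM)** — `θ_k ≤ 1` on a non-empty `T`, `0 < Θ < |T|`, `Σ_{k∈T}θ_k ≤ Θ`,
  `0 < η`, `n ≤ (|T|/Θ − 1)·log(|T|η)` ⇒ `s_n ≥ 1/η`; `sum_one_sub_pow_ge_of_sum_le` (Jensen with a bound on the sum).
* §3 **`lazy_lawAt_allMoved_le`** — `(δ_x ((I+P)/2)ⁿ){z : ∀ k ∈ T, z_k ≠ x_k} ≤ 1/Σ_{k∈T}(1−θ_k/2)ⁿ`;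
  **`lazy_mixingTime_ge_collector` (THE LAZY COUPON-COLLECTOR FLOOR)** — `θ_k ≤ θ` on a non-empty independent `T`
  (`0 < θ ≤ 1`), `π` stationary for `P`, `π{∃ k ∈ T, z_k = x_k} ≤ δ`, `0 < η`, `ε < 1 − η − δ`, the lazy chain `ε`-close
  at some time: **`t_mix^{lazy}(ε) ≥ (2/θ − 1)·log(|T|·η)`** — twice the non-lazy floor, as it must be.

Reading (no numerics implied): half of the lazy chain's steps are idle, so collecting every coordinate of `T` takes twice
as long; the floor doubles exactly.  NOT CLAIMED: anything beyond the abstract mixture (the sequel instantiates on hub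
lists and sets it against chapter K's lazy ceilings).  Literature grade (cell rule): OWN COMPOSITION; nothing cited as a
fact; no new bib keys.
-/

noncomputable section

open Finset Function
open Literature.Probability.MarkovChains

namespace Summit.Ventures.LatticeQCDFlow.Scaling

variable {S L ι : Type*} [Fintype S] [DecidableEq S] [Fintype L] [DecidableEq L] [Fintype ι]
  {c : ι → ℝ} {Pm : ι → (L → S) → (L → S) → ℝ} {τ : ι → Finset L}
  {P : (L → S) → (L → S) → ℝ}

/-! ## §1 The lazy version as a mixture over `Option ι` -/

omit [Fintype S] [DecidableEq S] [Fintype L] [DecidableEq L] [Fintype ι] in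
/-- The lazy weights `c'_{none} = 1/2`, `c'_{some a} = c_a/2` are non-negative. [ours] -/
theorem lazy_weights_nonneg (hc : ∀ a, 0 ≤ c a) :
    ∀ o : Option ι, 0 ≤ Option.elim o ((1 : ℝ) / 2) (fun a => c a / 2) := by
  rintro (_ | a)
  · simp only [Option.elim]; norm_num
  · simp only [Option.elim]; exact div_nonneg (hc a) (by norm_num)

omit [Fintype S] [DecidableEq S] [Fintype L] [DecidableEq L] in
/-- The lazy weights sum to one. [ours] -/
theorem lazy_weights_sum (hc1 : ∑ a, c a = 1) :
    ∑ o : Option ι, Option.elim o ((1 : ℝ) / 2) (fun a => c a / 2) = 1 := by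
  rw [Fintype.sum_option]
  simp only [Option.elim]
  rw [← Finset.sum_div, hc1]; norm_num

omit [Fintype ι] in
/-- The lazy kernels (`none` = the identity kernel) are transition matrices. [ours] -/
theorem lazy_kernels_isRowStochastic (hPm : ∀ a, IsRowStochastic (Pm a)) :
    ∀ o : Option ι, IsRowStochastic (Option.elim o (fun y z : L → S => if y = z then (1 : ℝ) else 0) Pm) := by
  rintro (_ | a)
  · refine ⟨fun y z => ?_, fun y => ?_⟩
    · show (0 : ℝ) ≤ (if y = z then (1 : ℝ) else 0)
      split_ifs <;> norm_num
    · show ∑ z, (if y = z then (1 : ℝ) else 0) = 1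
      rw [Finset.sum_ite_eq univ y, if_pos (mem_univ _)]
  · exact hPm a

omit [Fintype S] [DecidableEq L] [Fintype ι] in
/-- The lazy kernels are local (`none` touches nothing and moves nothing). [ours] -/
theorem lazy_kernels_local (hloc : ∀ a y z k, k ∉ τ a → Pm a y z ≠ 0 → z k = y k) :
    ∀ (o : Option ι) (y z : L → S) (k : L), k ∉ Option.elim o (∅ : Finset L) τ →
      Option.elim o (fun y z : L → S => if y = z then (1 : ℝ) else 0) Pm y z ≠ 0 → z k = y k := by
  rintro (_ | a) y z k hk h
  · change (if y = z then (1 : ℝ) else 0) ≠ 0 at h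
    by_cases hyz : y = z
    · rw [hyz]
    · exact absurd (if_neg hyz) h
  · exact hloc a y z k hk h

omit [Fintype S] [DecidableEq L] in
/-- **LAZINESS IS AN IDLE MOVE: `(I + P)/2 = Σ_{o : Option ι} c'_o·Pm'_o`.** [ours] -/
theorem lazyVersion_eq_mixture (hP : ∀ y z, P y z = ∑ a, c a * Pm a y z) (y z : L → S) :
    lazyVersion P y z = ∑ o : Option ι, Option.elim o ((1 : ℝ) / 2) (fun a => c a / 2) *
      Option.elim o (fun y z : L → S => if y = z then (1 : ℝ) else 0) Pm y z := by
  rw [lazyVersion_apply, Fintype.sum_option, hP]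
  change _ = 1 / 2 * (if y = z then (1 : ℝ) else 0) + ∑ a, c a / 2 * Pm a y z
  have h1 : ∑ a, c a / 2 * Pm a y z = (∑ a, c a * Pm a y z) / 2 := by
    rw [Finset.sum_div]; exact sum_congr rfl fun a _ => by ring
  rw [h1]
  split_ifs <;> ring

omit [Fintype S] [DecidableEq S] [Fintype L] in
/-- **THE LAZY TOUCH RATES ARE HALVED: `θ'_k = θ_k/2`.** [ours] -/
theorem lazy_touchRate (k : L) :
    ∑ o ∈ univ.filter (fun o : Option ι => k ∈ Option.elim o (∅ : Finset L) τ),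
        Option.elim o ((1 : ℝ) / 2) (fun a => c a / 2)
      = (∑ a ∈ univ.filter (fun a => k ∈ τ a), c a) / 2 := by
  rw [Finset.sum_filter, Fintype.sum_option]
  simp only [Option.elim, Finset.notMem_empty, if_false, zero_add]
  rw [Finset.sum_div, Finset.sum_filter]

omit [Fintype S] [DecidableEq S] [Fintype L] [DecidableEq L] [Fintype ι] in
/-- Independence of `T` is inherited by the lazy schedule. [ours] -/
theorem lazy_independent {T : Finset L} (hT : ∀ a, ∀ k ∈ T, ∀ l ∈ T, k ≠ l → ¬(k ∈ τ a ∧ l ∈ τ a)) :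
    ∀ o : Option ι, ∀ k ∈ T, ∀ l ∈ T, k ≠ l →
      ¬(k ∈ Option.elim o (∅ : Finset L) τ ∧ l ∈ Option.elim o (∅ : Finset L) τ) := by
  rintro (_ | a) k hk l hl hkl
  · simp only [Option.elim, Finset.notMem_empty, false_and, not_false_eq_true]
  · simp only [Option.elim]; exact hT a k hk l hl hkl

/-! ## §2 The average form of the collector bound -/

omit [Fintype S] [DecidableEq S] [Fintype L] [DecidableEq L] [Fintype ι] in
/-- **Jensen with a bound on the sum:** `θ_k ≤ 1` on a non-empty `T`, `Σ_{k∈T} θ_k ≤ Θ ≤ |T|` ⇒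
`Σ_{k∈T}(1−θ_k)ⁿ ≥ |T|·(1 − Θ/|T|)ⁿ`. [ours] -/
theorem sum_one_sub_pow_ge_of_sum_le {α : Type*} (T : Finset α) (hT : T.Nonempty) (θ : α → ℝ)
    (hθ1 : ∀ k ∈ T, θ k ≤ 1) {Θ : ℝ} (hΘ : ∑ k ∈ T, θ k ≤ Θ) (hΘT : Θ ≤ T.card) (n : ℕ) :
    (T.card : ℝ) * (1 - Θ / T.card) ^ n ≤ ∑ k ∈ T, (1 - θ k) ^ n := by
  have hTpos : (0 : ℝ) < T.card := Nat.cast_pos.mpr hT.card_pos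
  -- Jensen (`x ↦ xⁿ` convex on `[0, ∞)`) with weights `1/|T|`
  have hJ := (convexOn_pow n).map_sum_le (t := T) (w := fun _ => (1 : ℝ) / T.card) (p := fun k => 1 - θ k)
    (fun _ _ => by positivity) (by rw [sum_const, nsmul_eq_mul]; field_simp)
    (fun k hk => Set.mem_Ici.mpr (by linarith [hθ1 k hk]))
  simp only [smul_eq_mul] at hJ
  have hL : ∑ k ∈ T, (1 : ℝ) / T.card * (1 - θ k) = 1 - (∑ k ∈ T, θ k) / T.card := by
    rw [← mul_sum, sum_sub_distrib, sum_const, nsmul_eq_mul, mul_one]; field_simp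
  rw [hL, ← mul_sum] at hJ
  have hmono : (1 - Θ / T.card) ^ n ≤ (1 - (∑ k ∈ T, θ k) / T.card) ^ n := by
    apply pow_le_pow_left₀
    · rw [sub_nonneg, div_le_one hTpos]; exact hΘT
    · have := div_le_div_of_nonneg_right hΘ hTpos.le; linarith
  calc (T.card : ℝ) * (1 - Θ / T.card) ^ n ≤ (T.card : ℝ) * (1 - (∑ k ∈ T, θ k) / T.card) ^ n :=
        mul_le_mul_of_nonneg_left hmono hTpos.le
    _ ≤ (T.card : ℝ) * ((1 / T.card) * ∑ k ∈ T, (1 - θ k) ^ n) := mul_le_mul_of_nonneg_left hJ hTpos.le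
    _ = ∑ k ∈ T, (1 - θ k) ^ n := by field_simp

omit [Fintype S] [DecidableEq S] [Fintype L] [DecidableEq L] [Fintype ι] in
/-- **THE AVERAGE FORM OF THE COLLECTOR BOUND** (any rates `θ : α → ℝ`): `θ_k ≤ 1` on a non-empty `T`,
`Σ_{k∈T}θ_k ≤ Θ`, `0 < Θ < |T|`, `0 < η`, `n ≤ (|T|/Θ − 1)·log(|T|·η)` ⇒ **`Σ_{k∈T}(1−θ_k)ⁿ ≥ 1/η`**. [ours] -/
theorem touchSum_ge_of_sum_le_log {α : Type*} (T : Finset α) (hTne : T.Nonempty) (θ : α → ℝ)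
    (hθ1 : ∀ k ∈ T, θ k ≤ 1) {Θ η : ℝ} (hΘ0 : 0 < Θ) (hΘT : Θ < T.card) (hΘ : ∑ k ∈ T, θ k ≤ Θ) (hη : 0 < η)
    {n : ℕ} (hn : (n : ℝ) ≤ ((T.card : ℝ) / Θ - 1) * Real.log (T.card * η)) :
    1 / η ≤ ∑ k ∈ T, (1 - θ k) ^ n := by
  have hTpos : (0 : ℝ) < T.card := Nat.cast_pos.mpr hTne.card_pos
  have hTη : 0 < (T.card : ℝ) * η := mul_pos hTpos hη
  have hq0 : 0 < Θ / T.card := div_pos hΘ0 hTpos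
  have hq1 : Θ / T.card < 1 := (div_lt_one hTpos).mpr hΘT
  have h1 : 0 < 1 - Θ / T.card := by linarith
  have harg : (n : ℝ) * (Θ / T.card) / (1 - Θ / T.card) ≤ Real.log (T.card * η) := by
    have e : (T.card : ℝ) / Θ - 1 = (1 - Θ / T.card) / (Θ / T.card) := by field_simp
    rw [e] at hn
    have h := mul_le_mul_of_nonneg_left hn (div_pos hq0 h1).le
    have e1 : Θ / T.card / (1 - Θ / T.card) * ((1 - Θ / T.card) / (Θ / T.card) * Real.log (T.card * η))
        = Real.log (T.card * η) := by
      rw [← mul_assoc, div_mul_div_comm, mul_comm (Θ / T.card) (1 - Θ / T.card), div_self (mul_pos h1 hq0).ne',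
        one_mul]
    have e2 : Θ / T.card / (1 - Θ / T.card) * (n : ℝ) = n * (Θ / T.card) / (1 - Θ / T.card) := by ring
    rw [e1, e2] at h
    exact h
  calc 1 / η = (T.card : ℝ) * Real.exp (-Real.log (T.card * η)) := by
        rw [Real.exp_neg, Real.exp_log hTη]; field_simp
    _ ≤ (T.card : ℝ) * Real.exp (-(n * (Θ / T.card) / (1 - Θ / T.card))) :=
        mul_le_mul_of_nonneg_left (Real.exp_le_exp.mpr (neg_le_neg harg)) hTpos.le
    _ ≤ (T.card : ℝ) * (1 - Θ / T.card) ^ n := mul_le_mul_of_nonneg_left (one_sub_pow_ge_exp hq1 n) hTpos.le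
    _ ≤ _ := sum_one_sub_pow_ge_of_sum_le T hTne θ hθ1 hΘ hΘT.le n

/-! ## §3 The lazy coupon-collector floor -/

/-- **`(δ_x ((I+P)/2)ⁿ){z : ∀ k ∈ T, z_k ≠ x_k} ≤ 1/Σ_{k∈T}(1 − θ_k/2)ⁿ`** on a set `T` no move touches twice. [ours] -/
theorem lazy_lawAt_allMoved_le (hc : ∀ a, 0 ≤ c a) (hc1 : ∑ a, c a = 1)
    (hPm : ∀ a, IsRowStochastic (Pm a)) (hloc : ∀ a y z k, k ∉ τ a → Pm a y z ≠ 0 → z k = y k)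
    (hP : ∀ y z, P y z = ∑ a, c a * Pm a y z) (x : L → S) (T : Finset L)
    (hT : ∀ a, ∀ k ∈ T, ∀ l ∈ T, k ≠ l → ¬(k ∈ τ a ∧ l ∈ τ a)) (n : ℕ)
    (hs : 0 < ∑ k ∈ T, (1 - (∑ a ∈ univ.filter (fun a => k ∈ τ a), c a) / 2) ^ n) :
    ∑ z ∈ univ.filter (fun z : L → S => ∀ k ∈ T, z k ≠ x k), lawAt (lazyVersion P) (Pi.single x 1) n z
      ≤ 1 / ∑ k ∈ T, (1 - (∑ a ∈ univ.filter (fun a => k ∈ τ a), c a) / 2) ^ n := by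
  have hsum : ∑ k ∈ T, (1 - ∑ o ∈ univ.filter (fun o : Option ι => k ∈ Option.elim o (∅ : Finset L) τ),
        Option.elim o ((1 : ℝ) / 2) (fun a => c a / 2)) ^ n
      = ∑ k ∈ T, (1 - (∑ a ∈ univ.filter (fun a => k ∈ τ a), c a) / 2) ^ n :=
    sum_congr rfl fun k _ => by rw [lazy_touchRate (c := c) (τ := τ) k]
  have hs' := hs
  rw [← hsum] at hs'
  have h := lawAt_allMoved_le_inv (lazy_weights_nonneg hc) (lazy_weights_sum hc1) (lazy_kernels_isRowStochastic hPm)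
    (lazy_kernels_local hloc) (fun y z => lazyVersion_eq_mixture (c := c) (Pm := Pm) hP y z) x T
    (lazy_independent hT) n hs'
  rw [hsum] at h
  convert h using 2

/-- **THE LAZY COUPON-COLLECTOR FLOOR:** `θ_k ≤ θ` on a non-empty set `T` no move touches twice (`0 < θ ≤ 1`), `π`
stationary for `P`, `π{z : ∃ k ∈ T, z_k = x_k} ≤ δ`, `0 < η`, `ε < 1 − η − δ`, the lazy chain `ε`-close at some time:
**`t_mix^{lazy}(ε) ≥ (2/θ − 1)·log(|T|·η)`**. [ours] -/
theorem lazy_mixingTime_ge_collector (hc : ∀ a, 0 ≤ c a) (hc1 : ∑ a, c a = 1)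
    (hPm : ∀ a, IsRowStochastic (Pm a)) (hloc : ∀ a y z k, k ∉ τ a → Pm a y z ≠ 0 → z k = y k)
    (hP : ∀ y z, P y z = ∑ a, c a * Pm a y z) {π : (L → S) → ℝ} (hπ1 : ∑ z, π z = 1) (hst : IsStationary π P)
    (x : L → S) (T : Finset L) (hT : ∀ a, ∀ k ∈ T, ∀ l ∈ T, k ≠ l → ¬(k ∈ τ a ∧ l ∈ τ a)) (hTne : T.Nonempty)
    {θ η δ ε : ℝ} (hθ0 : 0 < θ) (hθ1 : θ ≤ 1) (hη : 0 < η)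
    (hθ : ∀ k ∈ T, ∑ a ∈ univ.filter (fun a => k ∈ τ a), c a ≤ θ)
    (hδ : ∑ z ∈ univ.filter (fun z : L → S => ∃ k ∈ T, z k = x k), π z ≤ δ) (hgap : ε < 1 - η - δ)
    (hmix : ∃ t₀, worstTvDist (lazyVersion P) π t₀ ≤ ε) :
    (2 / θ - 1) * Real.log (T.card * η) ≤ (mixingTime (lazyVersion P) π ε : ℝ) := by
  have hθ' : ∀ k ∈ T, ∑ o ∈ univ.filter (fun o : Option ι => k ∈ Option.elim o (∅ : Finset L) τ),
      Option.elim o ((1 : ℝ) / 2) (fun a => c a / 2) ≤ θ / 2 := fun k hk => by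
    rw [lazy_touchRate (c := c) (τ := τ) k]; exact div_le_div_of_nonneg_right (hθ k hk) (by norm_num)
  have e : (1 - θ / 2) / (θ / 2) = 2 / θ - 1 := by field_simp
  have h := mixingTime_ge_collector (lazy_weights_nonneg hc) (lazy_weights_sum hc1) (lazy_kernels_isRowStochastic hPm)
    (lazy_kernels_local hloc) (fun y z => lazyVersion_eq_mixture (c := c) (Pm := Pm) hP y z) hπ1
    (isStationary_lazyVersion hst) x T (lazy_independent hT) hTne (θ := θ / 2) (by positivity) (by linarith) hη hθ'
    (by convert hδ using 2) hgap hmix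
  rw [e] at h
  exact h

end Summit.Ventures.LatticeQCDFlow.Scaling

end
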